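import Literature.Geometry.Kaehler.ComplexTorusLineBundleIndexEndomorphismField
import HarnessLib

/-!
# A number field `K ↪ End_ℚ(X)` acting on a complex torus: the eigenspace decompositions
# `H₁(X, ℂ) = ⊕_σ V_σ` (equidimensional, `dim V_σ = 2g/[K:ℚ]` — Milne 1999 Prop. 2.1 for `k = ℂ`),
# `T₀X = ⊕_σ T_σ` (the multiplicities `n_σ` of `σ` on the tangent space) and
# `n_σ + n_σ̄ = 2g/[K:ℚ]` (Moonen–Zarhin 1998, (3))

Layer `Literature/Geometry/Kaehler`, namespace `Literature.Geometry.Kaehler.ComplexTorus`; lane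
`lit-hodgefound` (Track 2 foundations library), Layers A2/A4, self-proposed row «Q137⁺ ·
(`ComplexTorusEndomorphismSubfields`)⁺ · (`ComplexTorusLineBundleIndexEndomorphismField` §1/§4)⁺ · B5-25 · B1-23⁺ /
MZ98 §3 (3)» of `run/shared/lean/pub/lit-hodgefound/SKELETON.md` (p13, gen 6, row g6-#3). CONCRETE torus level,
model-free: `X = E/Φ(ℤ^ι)`, `V = H₁(X, ℚ) = ℚ^ι` (lattice basis), `V_ℂ = H₁(X, ℂ) = ℂ^ι`, `T₀X = E`,
`End_ℚ(X) = endAlgRat Φ ⊆ M_ι(ℚ)` with its analytic representation `ρ_a = analyticRepHom Φ : End_ℚ(X) → End_ℂ(E)`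
(`ComplexTorusAnalyticCharpoly`); a number field `K` acts through a `ℚ`-algebra map `f : K →ₐ[ℚ] M_ι(ℚ)`
(resp. with `f(K) ⊆ End_ℚ(X)`); `σ` ranges over the complex embeddings `K →+* ℂ` (`#Σ_K = [K:ℚ]`, Mathlib
`NumberField.Embeddings.card`), `σ̄ = NumberField.ComplexEmbedding.conjugate σ`.

## Sources, verbatim

* B. Moonen, Yu. Zarhin, *Weil classes on abelian varieties*, J. reine angew. Math. **496** (1998) 83–92 (held
  `paper:arxiv-alg-geom_9612017`, p0001 L35–L38 and L70–L80): "consider an abelian variety `X` of dimension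
  `g ≥ 1`, and suppose `F` is a subfield of `End⁰(X)`, with `1 ∈ F` acting as the identity on `X`. Write
  `V_X = H¹(X, ℚ)` and let `r = 2g/[F:ℚ]`." · **(3)** "Write `Σ_F` for the set of embeddings `F → ℂ`, and for
  `σ ∈ Σ_F`, let `σ'` denote its complex conjugate. The action of `F` on `V_X` gives a decomposition of
  `V_ℂ = V_X ⊗_ℚ ℂ` as `V_ℂ = ⊕_{σ ∈ Σ_F} V_{ℂ,σ} = ⊕_{σ ∈ Σ_F} (V^{1,0}_{ℂ,σ} ⊕ V^{0,1}_{ℂ,σ})`. The dimension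
  `n_σ` of `V^{1,0}_{ℂ,σ}` is called the multiplicity of `σ` on the tangent space of `X`; we have
  `n_σ + n_{σ'} = 2g/[F:ℚ]` for all `σ ∈ Σ_F`."
* J. S. Milne, *Lefschetz classes on abelian varieties*, Duke Math. J. **96** (1999) 639–675 (held
  `paper:doi-10-1215-s0012-7094-99-09620-5`, p0008–p0009), §2: "Let `F ⊗_ℚ k = F¹ × ⋯ × Fᵗ`, be the
  decomposition of `F ⊗_ℚ k` into a product of fields […] Then `V(A) = V₁ ⊕ ⋯ ⊕ V_t`, `V_i = e_i V = V ⊗_{F⊗k} F_i`.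
  Proposition 2.1 below shows that `V_i` has dimension `2g/f` over `F_i`." · **Proposition 2.1.** "Let `A` be an
  abelian variety, and let `L` be a subfield of `End⁰(A)` containing the identity map. Then `V(A)` is a free
  `L ⊗_ℚ k`-module of rank `2 dim A/[L:ℚ]`." · Proof: "Let `α ∈ L`. The characteristic polynomial `P_{A,α}(X)` of
  `α` as an endomorphism of `A` is monic of degree `2 dim A` with coefficients in `ℚ`, and it is equal to the
  characteristic polynomial of `V(α)` acting on the `k`-vector space `V(A)` […] If we assume that `α` generates `L`
  as a field extension of `ℚ`, so that `P_{L/ℚ,α}(X)` is irreducible, then […] `P_{A,α}(X) = P_{L/ℚ,α}(X)^m` for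
  some integer `m` and that each `m_i = m`. On equating the degrees, we find that `2 dim A = m[L:ℚ]`."
* H. Lange, *Abelian Varieties over the Complex Numbers* (Springer 2023), §1.1.2 (the analytic and rational
  representations, `ρ_r ⊗ 1 ≅ ρ_a ⊕ ρ̄_a`, Prop. 1.2.3) and §2.4.1 Prop. 2.4.3 (a): "`P^r_f = P^a_f · \overline{P^a_f}`"
  (the tree's `charpoly_map_eq_charpoly_analyticRepHom_mul_conj`); §2.6.1 p. 139 ("`Λ ⊗ ℚ` is a vector space
  over the skew field `F`", the tree's `exists_charpoly_algHom_eq_minpoly_pow`: `P_{f(x)} = (minpoly_ℚ x)^N`,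
  `deg(minpoly_ℚ x) · N = |ι|` — Milne's "`P_{A,α} = P_{L/ℚ,α}^m`").

## What is proved (torus level, Betti theory `k = ℂ`; theorems only — no definition, no named fact, net debt 0)

Milne's Prop. 2.1 is stated for an arbitrary Weil cohomology `V(A)` with coefficient field `k`; for the Betti
theory base-changed to `k = ℂ` (where `L ⊗_ℚ ℂ = ∏_{σ ∈ Σ_L} ℂ`, the idempotents `e_σ` cutting out the
simultaneous eigenspaces `V_σ = {v | (f y)v = σ(y)v ∀ y ∈ L}`) "free of rank `2 dim A/[L:ℚ]`" says exactly that
`V_ℂ = ⊕_σ V_σ` with EVERY `V_σ` of dimension `2g/[L:ℚ]`; this is what §1 proves, by Milne's own argument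
(characteristic polynomial of a generator `= P_{L/ℚ,α}^m`). The simultaneous eigenspaces are written out as
`⨅ y : K, eigenspace ((f y)_ℂ) (σ y)` (no new notion is introduced).

* §0 (generic; sub-namespace `NumberFieldAction`): for ANY ring map `g : K → End_ℂ(W)`, `W` a finite-dimensional
  `ℂ`-space: each `g x` is annihilated by the separable polynomial `minpoly_ℚ x`, hence SEMISIMPLE
  (`isSemisimple_apply`), so `W = ⊕_μ ker(g x − μ)` (`iSup_eigenspace_eq_top`) with
  `dim ker(g x − μ) = mult_μ P_{g x}` (`finrank_eigenspace_eq_rootMultiplicity`) and `ker(g x − μ) = 0` off the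
  conjugates of `x` (`eigenspace_eq_bot_of_aeval_ne_zero`); for a primitive element `θ` (`ℚ(θ) = K`) the
  simultaneous eigenspace is `W_σ = ker(g θ − σθ)` (`iInf_eigenspace_eq_eigenspace`), and
  **`W = ⊕_{σ : K → ℂ} W_σ`** (`iSupIndep_iInf_eigenspace`, `iSup_iInf_eigenspace_eq_top`,
  `sum_finrank_iInf_eigenspace_eq`: `Σ_σ dim W_σ = dim W`); `dim W_σ + dim W_σ̄ = mult_{σθ}(P_{gθ} · P̄_{gθ})`
  (`finrank_iInf_eigenspace_add_conjugate_eq`).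
* §1 **Milne 1999 Prop. 2.1 (`k = ℂ`) / MZ98 (3) "`V_ℂ = ⊕_σ V_{ℂ,σ}`"** for `f : K →ₐ[ℚ] M_ι(ℚ)` acting on
  `V_ℂ = ℂ^ι`: `V_ℂ = ⊕_σ V_σ` (`iSupIndep_iInf_eigenspace_toLin'_map`, `iSup_iInf_eigenspace_toLin'_map_eq_top`),
  **`finrank_iInf_eigenspace_toLin'_map_mul_finrank`: `dim_ℂ V_σ · [K:ℚ] = |ι| (= 2g)` for EVERY `σ`**, and for a
  single `x ∈ K`: `dim ker((f x)_ℂ − μ) · deg(minpoly_ℚ x) = |ι|` at every conjugate `μ` of `x`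
  (`finrank_eigenspace_toLin'_map_mul_natDegree`), `= 0` elsewhere (`eigenspace_toLin'_map_eq_bot`),
  `ℂ^ι = ⊕_μ ker((f x)_ℂ − μ)` (`iSup_eigenspace_toLin'_map_eq_top`); `[K:ℚ] ∣ |ι|` (`finrank_dvd_card_of_algHom`;
  cf. `finrank_dvd_card_of_le_endAlgRat` of `ComplexTorusEndomorphismSubfields` for subfields of `M_ι(ℚ)`).
* §2 **MZ98 (3), the tangent space**, for `f(K) ⊆ End_ℚ(X)`: with `T_σ = {v ∈ T₀X | ρ_a(f y)v = σ(y)v ∀ y}` and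
  **`n_σ = dim_ℂ T_σ` "the multiplicity of `σ` on the tangent space of `X`"**: `ρ_a(f x)` is semisimple
  (`isSemisimple_analyticRepHom`), **`T₀X = ⊕_σ T_σ`** (`iSupIndep_iInf_eigenspace_analyticRepHom`,
  `iSup_iInf_eigenspace_analyticRepHom_eq_top`, `sum_finrank_iInf_eigenspace_analyticRepHom_eq`: `Σ_σ n_σ = g`),
  and **`finrank_iInf_eigenspace_analyticRepHom_add_conjugate_mul_finrank`: `(n_σ + n_σ̄) · [K:ℚ] = 2g`** — via
  `P^r = P^a · \overline{P^a}` (Prop. 2.4.3 (a)): `dim V_σ = mult_{σθ} P^r_{fθ} = mult_{σθ} P^a + mult_{σ̄θ} P^a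
  = n_σ + n_σ̄`; the single-element form `finrank_eigenspace_analyticRepHom_add_conj_mul_natDegree`.
  (MZ98's `V_X = H¹(X, ℚ)` is the dual of the tree's `V = H₁(X, ℚ)`; its `V^{1,0}_{ℂ,σ}` is dual to `T_σ`, whence
  "multiplicity of `σ` on the tangent space"; the numbers `dim V_{ℂ,σ}`, `n_σ` are the same on either side.)

NOT here: MZ98's space of Weil classes `W_F = ⋀^r_F V_X ⊂ H^r(X, ℚ)` for a general `F` and Criterion (4) (the
imaginary quadratic case is `ComplexTorusWeilTypeHodgeCycles`, A4-40); the Track-1 abstract twin on the carrier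
`ℂ ⊗_ℚ V` of a number-field action on an abstract Hodge structure
(`Motives.HodgeStructure.EndAction.finrank_iInf_eigenspace_mul_finrank`, `Motives/WeilTypeCMProofs`) is neither
imported nor restated.

## References

* [MoonenZarhin1998WeilClasses] B. Moonen, Yu. Zarhin, *Weil classes on abelian varieties*, J. reine angew. Math.
  496 (1998), §3 (3).
* [Milne1999LefschetzClasses] J. S. Milne, *Lefschetz classes on abelian varieties*, Duke Math. J. 96 (1999), §2
  Prop. 2.1 and its proof.
* [Lange2023AbelianVarietiesComplex] H. Lange, *Abelian Varieties over the Complex Numbers* (2023), §1.1.2,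
  §2.4.1 Prop. 2.4.3 (a), §2.6.1 p. 139.
-/

noncomputable section

open Polynomial Module Matrix Complex NumberField
open scoped ComplexConjugate IntermediateField

namespace Literature.Geometry.Kaehler

namespace ComplexTorus

/-! ## §0 Generic: a number field acting on a finite-dimensional complex vector space -/

namespace NumberFieldAction

section Generic

variable {K : Type*} [Field K] [NumberField K] {W : Type*} [AddCommGroup W] [Module ℂ W]
  [FiniteDimensional ℂ W] (g : K →+* Module.End ℂ W)

omit [FiniteDimensional ℂ W] in
/-- A ring map out of a number field agrees with the structure map on the rational scalars. [folklore] -/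
private theorem comp_algebraMap_rat_eq :
    g.comp (algebraMap ℚ K) = (algebraMap ℂ (Module.End ℂ W)).comp (algebraMap ℚ ℂ) :=
  RingHom.ext_rat _ _

omit [FiniteDimensional ℂ W] in
/-- `g(p(x)) = p_ℂ(g(x))` for `p ∈ ℚ[X]`. [folklore] -/
private theorem map_aeval_eq (x : K) (p : ℚ[X]) :
    g (aeval x p) = aeval (g x) (p.map (algebraMap ℚ ℂ)) := by
  rw [aeval_def, hom_eval₂, aeval_def, eval₂_map, comp_algebraMap_rat_eq]

/-- `σ(p(x)) = p_ℂ(σ x)` for an embedding `σ : K → ℂ` and `p ∈ ℚ[X]`. [folklore] -/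
private theorem embedding_aeval_eq (σ : K →+* ℂ) (x : K) (p : ℚ[X]) :
    σ (aeval x p) = (p.map (algebraMap ℚ ℂ)).eval (σ x) := by
  rw [aeval_def, hom_eval₂, eval_map, RingHom.ext_rat (σ.comp (algebraMap ℚ K)) (algebraMap ℚ ℂ)]

/-- `σ x` is a root of the minimal polynomial of `x` ("the images of `x` by the embeddings are the roots of the
minimal polynomial", Mathlib `NumberField.Embeddings.range_eval_eq_rootSet_minpoly`).
[cite: Milne1999LefschetzClasses, §2 proof of Prop. 2.1] -/
theorem aeval_embedding_minpoly (σ : K →+* ℂ) (x : K) : aeval (σ x) (minpoly ℚ x) = 0 := by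
  rw [← eval_map_algebraMap, ← embedding_aeval_eq, minpoly.aeval, map_zero]

omit [FiniteDimensional ℂ W] in
/-- `g x` is annihilated by (the complexification of) the minimal polynomial `P_{K/ℚ,x}` of `x`.
[cite: Milne1999LefschetzClasses, §2 proof of Prop. 2.1] -/
theorem aeval_map_minpoly_eq_zero (x : K) :
    aeval (g x) ((minpoly ℚ x).map (algebraMap ℚ ℂ)) = 0 := by
  rw [← map_aeval_eq, minpoly.aeval, map_zero]

/-- The minimal polynomial of an element of a number field has simple roots in `ℂ`. [folklore] -/
private theorem separable_map_minpoly (x : K) : ((minpoly ℚ x).map (algebraMap ℚ ℂ)).Separable :=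
  (minpoly.irreducible (Algebra.IsIntegral.isIntegral (R := ℚ) x)).separable.map

omit [FiniteDimensional ℂ W] in
/-- **Each `g x` is a semisimple endomorphism** (it is annihilated by the separable polynomial `P_{K/ℚ,x}`; this is
the content of "`L ⊗_ℚ k` is a product of fields" for `k = ℂ`). [cite: Milne1999LefschetzClasses, §2 (`F ⊗_ℚ k = F¹ × ⋯ × Fᵗ`) and proof of Prop. 2.1] -/
theorem isSemisimple_apply (x : K) : (g x).IsSemisimple :=
  Module.End.isSemisimple_of_squarefree_aeval_eq_zero (separable_map_minpoly x).squarefree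
    (aeval_map_minpoly_eq_zero g x)

/-- For a semisimple endomorphism the geometric and algebraic multiplicities agree:
`dim ker(g x − μ) = mult_μ P_{g x}`. [cite: Milne1999LefschetzClasses, §2 proof of Prop. 2.1 ("it is equal to the characteristic polynomial of `V(α)`")] -/
theorem finrank_eigenspace_eq_rootMultiplicity (x : K) (μ : ℂ) :
    finrank ℂ ((g x).eigenspace μ) = (g x).charpoly.rootMultiplicity μ := by
  rw [← (isSemisimple_apply g x).isFinitelySemisimple.maxGenEigenspace_eq_eigenspace,
    LinearMap.finrank_maxGenEigenspace_eq]

/-- `W = ⊕_μ ker(g x − μ)`: a semisimple endomorphism of a complex vector space is diagonalisable.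
[cite: Milne1999LefschetzClasses, §2 (`V(A) = V₁ ⊕ ⋯ ⊕ V_t`)] -/
theorem iSup_eigenspace_eq_top (x : K) : ⨆ μ : ℂ, (g x).eigenspace μ = ⊤ :=
  (isSemisimple_apply g x).iSup_eigenspace_eq_top

omit [FiniteDimensional ℂ W] in
/-- Only the conjugates of `x` occur as eigenvalues of `g x`. [cite: Milne1999LefschetzClasses, §2 proof of Prop. 2.1 ("any monic irreducible factor of `P_{A,α}` … shares a root with `P_{L/ℚ,α}`")] -/
theorem eigenspace_eq_bot_of_aeval_ne_zero (x : K) {μ : ℂ} (hμ : aeval μ (minpoly ℚ x) ≠ 0) :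
    (g x).eigenspace μ = ⊥ := by
  by_contra hne
  have hroot := Module.End.isRoot_of_hasEigenvalue (Module.End.hasEigenvalue_iff.mpr hne)
  have hdvd : minpoly ℂ (g x) ∣ (minpoly ℚ x).map (algebraMap ℚ ℂ) :=
    minpoly.dvd _ _ (aeval_map_minpoly_eq_zero g x)
  exact hμ (by rw [← eval_map_algebraMap]; exact hroot.dvd hdvd)

/-- Every element of `K = ℚ(θ)` is a rational polynomial in `θ`. [folklore] -/
private theorem exists_aeval_eq_of_adjoin_eq_top {θ : K} (hθ : ℚ⟮θ⟯ = ⊤) (y : K) :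
    ∃ p : ℚ[X], aeval θ p = y := by
  have hy : y ∈ (ℚ⟮θ⟯).toSubalgebra := by rw [hθ]; exact IntermediateField.mem_top
  rwa [IntermediateField.adjoin_simple_toSubalgebra_of_isAlgebraic (Algebra.IsAlgebraic.isAlgebraic θ),
    Algebra.adjoin_singleton_eq_range_aeval] at hy

omit [FiniteDimensional ℂ W] in
/-- **The simultaneous eigenspace `W_σ` is the `σθ`-eigenspace of a generator**: if `K = ℚ(θ)` ("assume that `α`
generates `L` as a field extension of `ℚ`"), then `{w | g(y)w = σ(y)w ∀ y ∈ K} = ker(g θ − σθ)`.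
[cite: Milne1999LefschetzClasses, §2 proof of Prop. 2.1] -/
theorem iInf_eigenspace_eq_eigenspace {θ : K} (hθ : ℚ⟮θ⟯ = ⊤) (σ : K →+* ℂ) :
    (⨅ y : K, (g y).eigenspace (σ y)) = (g θ).eigenspace (σ θ) := by
  refine le_antisymm (iInf_le _ θ) (le_iInf fun y => ?_)
  intro v hv
  obtain ⟨p, rfl⟩ := exists_aeval_eq_of_adjoin_eq_top hθ y
  rw [Module.End.mem_eigenspace_iff, map_aeval_eq, embedding_aeval_eq]
  by_cases hv0 : v = 0
  · simp [hv0]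
  · exact Module.End.aeval_apply_of_hasEigenvector (Module.End.hasEigenvector_iff.mpr ⟨hv, hv0⟩)

/-- An embedding of `K = ℚ(θ)` is determined by its value at `θ`. [folklore] -/
private theorem embedding_injective_of_adjoin_eq_top {θ : K} (hθ : ℚ⟮θ⟯ = ⊤) :
    Function.Injective fun σ : K →+* ℂ => σ θ := by
  intro σ τ h
  refine RingHom.ext fun y => ?_
  obtain ⟨p, rfl⟩ := exists_aeval_eq_of_adjoin_eq_top hθ y
  simp only at h
  rw [embedding_aeval_eq, embedding_aeval_eq, h]

omit [FiniteDimensional ℂ W] in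
/-- **The simultaneous eigenspaces `W_σ`, `σ : K → ℂ`, are independent** (distinct embeddings take distinct values
at a generator). [cite: MoonenZarhin1998WeilClasses, §3 (3) (`V_ℂ = ⊕_{σ ∈ Σ_F} V_{ℂ,σ}`)] -/
theorem iSupIndep_iInf_eigenspace :
    iSupIndep fun σ : K →+* ℂ => ⨅ y : K, (g y).eigenspace (σ y) := by
  obtain ⟨θ, hθ⟩ := Field.exists_primitive_element ℚ K
  simp_rw [iInf_eigenspace_eq_eigenspace g hθ]
  exact (g θ).eigenspaces_iSupIndep.comp (embedding_injective_of_adjoin_eq_top hθ)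

/-- **The simultaneous eigenspaces `W_σ`, `σ : K → ℂ`, span `W`**: every eigenvalue of `g θ` is a conjugate
`σθ` of the generator `θ` (Mathlib `NumberField.Embeddings.range_eval_eq_rootSet_minpoly`), and `g θ` is
diagonalisable. Together with `iSupIndep_iInf_eigenspace`: `W = ⊕_σ W_σ`.
[cite: MoonenZarhin1998WeilClasses, §3 (3) (`V_ℂ = ⊕_{σ ∈ Σ_F} V_{ℂ,σ}`)] [cite: Milne1999LefschetzClasses, §2 (`V(A) = V₁ ⊕ ⋯ ⊕ V_t`)] -/
theorem iSup_iInf_eigenspace_eq_top :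
    ⨆ σ : K →+* ℂ, (⨅ y : K, (g y).eigenspace (σ y)) = ⊤ := by
  obtain ⟨θ, hθ⟩ := Field.exists_primitive_element ℚ K
  simp_rw [iInf_eigenspace_eq_eigenspace g hθ]
  refine top_le_iff.mp ?_
  rw [← iSup_eigenspace_eq_top g θ]
  refine iSup_le fun μ => ?_
  by_cases hμ : aeval μ (minpoly ℚ θ) = 0
  · have hmem : μ ∈ Set.range fun φ : K →+* ℂ => φ θ := by
      rw [NumberField.Embeddings.range_eval_eq_rootSet_minpoly, Polynomial.mem_rootSet]
      exact ⟨minpoly.ne_zero (Algebra.IsIntegral.isIntegral (R := ℚ) θ), hμ⟩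
    obtain ⟨σ, rfl⟩ := hmem
    exact le_iSup (fun σ : K →+* ℂ => (g θ).eigenspace (σ θ)) σ
  · rw [eigenspace_eq_bot_of_aeval_ne_zero g θ hμ]
    exact bot_le

/-- `Σ_σ dim W_σ = dim W` (the decomposition `W = ⊕_σ W_σ` is direct and exhaustive).
[cite: MoonenZarhin1998WeilClasses, §3 (3)] -/
theorem sum_finrank_iInf_eigenspace_eq :
    ∑ σ : K →+* ℂ, finrank ℂ ↥(⨅ y : K, (g y).eigenspace (σ y)) = finrank ℂ W := by
  classical
  have h := DirectSum.isInternal_submodule_of_iSupIndep_of_iSup_eq_top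
    (iSupIndep_iInf_eigenspace g) (iSup_iInf_eigenspace_eq_top g)
  rw [← (LinearEquiv.ofBijective (DirectSum.coeLinearMap _) h).finrank_eq, finrank_directSum]

/-- `dim W_σ = mult_{σθ} P_{gθ}` for a generator `θ` of `K`. [cite: Milne1999LefschetzClasses, §2 proof of Prop. 2.1] -/
theorem finrank_iInf_eigenspace_eq_rootMultiplicity {θ : K} (hθ : ℚ⟮θ⟯ = ⊤) (σ : K →+* ℂ) :
    finrank ℂ ↥(⨅ y : K, (g y).eigenspace (σ y)) = (g θ).charpoly.rootMultiplicity (σ θ) := by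
  rw [iInf_eigenspace_eq_eigenspace g hθ, finrank_eigenspace_eq_rootMultiplicity]

/-- Root multiplicities of `\overline{P}` are those of `P` at the conjugate point. [folklore] -/
private theorem rootMultiplicity_map_conj (P : ℂ[X]) (μ : ℂ) :
    (P.map (starRingEnd ℂ)).rootMultiplicity μ = P.rootMultiplicity (conj μ) := by
  conv_lhs => rw [← conj_conj μ]
  exact (eq_rootMultiplicity_map (RingHom.injective (starRingEnd ℂ)) (conj μ)).symm

/-- `dim ker(g x − μ) + dim ker(g x − μ̄) = mult_μ (P_{gx} · \overline{P_{gx}})`.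
[cite: Lange2023AbelianVarietiesComplex, §2.4.1 Prop. 2.4.3 (a) (`P^r_f = P^a_f · \overline{P^a_f}`)] -/
theorem finrank_eigenspace_add_conj_eq (x : K) (μ : ℂ) :
    finrank ℂ ((g x).eigenspace μ) + finrank ℂ ((g x).eigenspace (conj μ)) =
      ((g x).charpoly * ((g x).charpoly).map (starRingEnd ℂ)).rootMultiplicity μ := by
  rw [finrank_eigenspace_eq_rootMultiplicity, finrank_eigenspace_eq_rootMultiplicity, ← rootMultiplicity_map_conj,
    ← rootMultiplicity_mul]
  exact mul_ne_zero (LinearMap.charpoly_monic _).ne_zero (Polynomial.map_monic_ne_zero (LinearMap.charpoly_monic _))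

/-- `dim W_σ + dim W_σ̄ = mult_{σθ} (P_{gθ} · \overline{P_{gθ}})` for a generator `θ` of `K` (`σ̄θ = \overline{σθ}`).
[cite: MoonenZarhin1998WeilClasses, §3 (3) (`n_σ + n_{σ'}`)] [cite: Lange2023AbelianVarietiesComplex, §2.4.1 Prop. 2.4.3 (a)] -/
theorem finrank_iInf_eigenspace_add_conjugate_eq {θ : K} (hθ : ℚ⟮θ⟯ = ⊤) (σ : K →+* ℂ) :
    finrank ℂ ↥(⨅ y : K, (g y).eigenspace (σ y)) +
        finrank ℂ ↥(⨅ y : K, (g y).eigenspace (NumberField.ComplexEmbedding.conjugate σ y)) =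
      ((g θ).charpoly * ((g θ).charpoly).map (starRingEnd ℂ)).rootMultiplicity (σ θ) := by
  rw [finrank_iInf_eigenspace_eq_rootMultiplicity g hθ, finrank_iInf_eigenspace_eq_rootMultiplicity g hθ,
    NumberField.ComplexEmbedding.conjugate_coe_eq, ← rootMultiplicity_map_conj, ← rootMultiplicity_mul]
  exact mul_ne_zero (LinearMap.charpoly_monic _).ne_zero (Polynomial.map_monic_ne_zero (LinearMap.charpoly_monic _))

/-- Root multiplicities of `(P_{K/ℚ,x})^N` read in `ℂ`: `N` at the conjugates of `x` (simple roots of the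
separable `P_{K/ℚ,x}`), `0` elsewhere. [cite: Milne1999LefschetzClasses, §2 proof of Prop. 2.1 (`P_{A,α} = P_{L/ℚ,α}^m`)] -/
theorem rootMultiplicity_map_minpoly_pow (x : K) (N : ℕ) (μ : ℂ) :
    (((minpoly ℚ x) ^ N).map (algebraMap ℚ ℂ)).rootMultiplicity μ =
      if aeval μ (minpoly ℚ x) = 0 then N else 0 := by
  classical
  have hne : (minpoly ℚ x).map (algebraMap ℚ ℂ) ≠ 0 :=
    Polynomial.map_ne_zero (minpoly.ne_zero (Algebra.IsIntegral.isIntegral (R := ℚ) x))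
  rw [← count_roots, Polynomial.map_pow, roots_pow, Multiset.count_nsmul]
  split_ifs with h
  · rw [Multiset.count_eq_one_of_mem (nodup_roots (separable_map_minpoly x)) ?_, mul_one]
    rwa [mem_roots hne, IsRoot, eval_map_algebraMap]
  · rw [Multiset.count_eq_zero_of_notMem ?_, mul_zero]
    rwa [mem_roots hne, IsRoot, eval_map_algebraMap]

end Generic

end NumberFieldAction

open NumberFieldAction

/-! ## §1 `V_ℂ = H₁(X, ℂ) = ℂ^ι` under a number field `K → M_ι(ℚ)`: `V_ℂ = ⊕_σ V_σ`, `dim V_σ = 2g/[K:ℚ]`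
(Milne 1999 Prop. 2.1 for `k = ℂ`; MZ98 (3) first display) -/

section MatrixField

variable {ι : Type*} [Fintype ι] [DecidableEq ι] {K : Type*} [Field K] [NumberField K]
  (f : K →ₐ[ℚ] Matrix ι ι ℚ)

/-- The complexified action `x ↦ (f x) ⊗ 1` of `K` on `ℂ^ι`, written as the ring map
`K → M_ι(ℚ) → M_ι(ℂ) ≅ End_ℂ(ℂ^ι)`, is `x ↦ toLin' ((f x)_ℂ)`. [folklore] -/
private theorem cpx_apply (x : K) :
    ((Matrix.toLinAlgEquiv' : Matrix ι ι ℂ ≃ₐ[ℂ] Module.End ℂ (ι → ℂ)).toRingEquiv.toRingHom.comp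
      (((algebraMap ℚ ℂ).mapMatrix).comp (f : K →+* Matrix ι ι ℚ))) x =
      Matrix.toLin' ((f x).map (algebraMap ℚ ℂ)) := rfl

/-- The characteristic polynomial of `(f x) ⊗ 1` on `V_ℂ` is that of `f x` on `V` ("it is equal to the
characteristic polynomial of `V(α)` acting on the `k`-vector space `V(A)`"). [cite: Milne1999LefschetzClasses, §2 proof of Prop. 2.1] -/
theorem charpoly_toLin'_map (x : K) :
    (Matrix.toLin' ((f x).map (algebraMap ℚ ℂ))).charpoly = (f x).charpoly.map (algebraMap ℚ ℂ) := by
  rw [Matrix.charpoly_toLin', Matrix.charpoly_map]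

/-- `(f x) ⊗ 1` is a semisimple endomorphism of `V_ℂ` (`K ⊗_ℚ ℂ` is a product of fields).
[cite: Milne1999LefschetzClasses, §2 (`F ⊗_ℚ k = F¹ × ⋯ × Fᵗ`, `V(A) = V₁ ⊕ ⋯ ⊕ V_t`)] -/
theorem isSemisimple_toLin'_map (x : K) :
    Module.End.IsSemisimple (Matrix.toLin' ((f x).map (algebraMap ℚ ℂ))) :=
  isSemisimple_apply
    ((Matrix.toLinAlgEquiv' : Matrix ι ι ℂ ≃ₐ[ℂ] Module.End ℂ (ι → ℂ)).toRingEquiv.toRingHom.comp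
      (((algebraMap ℚ ℂ).mapMatrix).comp (f : K →+* Matrix ι ι ℚ))) x

/-- `V_ℂ = ⊕_μ ker((f x)_ℂ − μ)`: `(f x) ⊗ 1` is diagonalisable on `V_ℂ`.
[cite: Milne1999LefschetzClasses, §2 (`V(A) = V₁ ⊕ ⋯ ⊕ V_t`)] -/
theorem iSup_eigenspace_toLin'_map_eq_top (x : K) :
    ⨆ μ : ℂ, Module.End.eigenspace (Matrix.toLin' ((f x).map (algebraMap ℚ ℂ))) μ = ⊤ :=
  iSup_eigenspace_eq_top
    ((Matrix.toLinAlgEquiv' : Matrix ι ι ℂ ≃ₐ[ℂ] Module.End ℂ (ι → ℂ)).toRingEquiv.toRingHom.comp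
      (((algebraMap ℚ ℂ).mapMatrix).comp (f : K →+* Matrix ι ι ℚ))) x

/-- **Prop. 2.1 for one element, `k = ℂ`**: for `x ∈ K` and a conjugate `μ ∈ ℂ` of `x`,
`dim_ℂ ker((f x)_ℂ − μ) · deg P_{K/ℚ,x} = |ι| = 2g` — Milne's "`P_{A,α}(X) = P_{L/ℚ,α}(X)^m` […] each `m_i = m`
[…] `2 dim A = m[L:ℚ]`" for `L = ℚ(x)` (the power `P_{f(x)} = (minpoly_ℚ x)^N` is the tree's
`exists_charpoly_algHom_eq_minpoly_pow`). [cite: Milne1999LefschetzClasses, §2 Prop. 2.1 (proof)] -/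
theorem finrank_eigenspace_toLin'_map_mul_natDegree (x : K) {μ : ℂ} (hμ : aeval μ (minpoly ℚ x) = 0) :
    finrank ℂ (Module.End.eigenspace (Matrix.toLin' ((f x).map (algebraMap ℚ ℂ))) μ) * (minpoly ℚ x).natDegree =
      Fintype.card ι := by
  obtain ⟨N, hN, hdeg⟩ := exists_charpoly_algHom_eq_minpoly_pow f x
  rw [← cpx_apply, finrank_eigenspace_eq_rootMultiplicity
    ((Matrix.toLinAlgEquiv' : Matrix ι ι ℂ ≃ₐ[ℂ] Module.End ℂ (ι → ℂ)).toRingEquiv.toRingHom.comp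
      (((algebraMap ℚ ℂ).mapMatrix).comp (f : K →+* Matrix ι ι ℚ))) x μ, cpx_apply, charpoly_toLin'_map, hN,
    rootMultiplicity_map_minpoly_pow, if_pos hμ, mul_comm, hdeg]

/-- Off the conjugates of `x`, `(f x)_ℂ − μ` is injective. [cite: Milne1999LefschetzClasses, §2 Prop. 2.1 (proof)] -/
theorem eigenspace_toLin'_map_eq_bot (x : K) {μ : ℂ} (hμ : aeval μ (minpoly ℚ x) ≠ 0) :
    Module.End.eigenspace (Matrix.toLin' ((f x).map (algebraMap ℚ ℂ))) μ = ⊥ :=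
  eigenspace_eq_bot_of_aeval_ne_zero
    ((Matrix.toLinAlgEquiv' : Matrix ι ι ℂ ≃ₐ[ℂ] Module.End ℂ (ι → ℂ)).toRingEquiv.toRingHom.comp
      (((algebraMap ℚ ℂ).mapMatrix).comp (f : K →+* Matrix ι ι ℚ))) x hμ

/-- For a generator `θ` of `K` the simultaneous eigenspace `V_σ = {v | (f y)_ℂ v = σ(y) v ∀ y}` is
`ker((f θ)_ℂ − σθ)`. [cite: Milne1999LefschetzClasses, §2 Prop. 2.1 (proof, "assume that `α` generates `L`")] -/
theorem iInf_eigenspace_toLin'_map_eq_eigenspace {θ : K} (hθ : ℚ⟮θ⟯ = ⊤) (σ : K →+* ℂ) :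
    (⨅ y : K, Module.End.eigenspace (Matrix.toLin' ((f y).map (algebraMap ℚ ℂ))) (σ y)) =
      Module.End.eigenspace (Matrix.toLin' ((f θ).map (algebraMap ℚ ℂ))) (σ θ) :=
  iInf_eigenspace_eq_eigenspace
    ((Matrix.toLinAlgEquiv' : Matrix ι ι ℂ ≃ₐ[ℂ] Module.End ℂ (ι → ℂ)).toRingEquiv.toRingHom.comp
      (((algebraMap ℚ ℂ).mapMatrix).comp (f : K →+* Matrix ι ι ℚ))) hθ σ

/-- **`V_ℂ = ⊕_{σ ∈ Σ_K} V_σ`, independence.** [cite: MoonenZarhin1998WeilClasses, §3 (3) (`V_ℂ = ⊕_{σ ∈ Σ_F} V_{ℂ,σ}`)] [cite: Milne1999LefschetzClasses, §2 (`V(A) = V₁ ⊕ ⋯ ⊕ V_t`)] -/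
theorem iSupIndep_iInf_eigenspace_toLin'_map :
    iSupIndep fun σ : K →+* ℂ => ⨅ y : K, Module.End.eigenspace (Matrix.toLin' ((f y).map (algebraMap ℚ ℂ))) (σ y) :=
  iSupIndep_iInf_eigenspace
    ((Matrix.toLinAlgEquiv' : Matrix ι ι ℂ ≃ₐ[ℂ] Module.End ℂ (ι → ℂ)).toRingEquiv.toRingHom.comp
      (((algebraMap ℚ ℂ).mapMatrix).comp (f : K →+* Matrix ι ι ℚ)))

/-- **`V_ℂ = ⊕_{σ ∈ Σ_K} V_σ`, spanning.** [cite: MoonenZarhin1998WeilClasses, §3 (3) (`V_ℂ = ⊕_{σ ∈ Σ_F} V_{ℂ,σ}`)] [cite: Milne1999LefschetzClasses, §2 (`V(A) = V₁ ⊕ ⋯ ⊕ V_t`)] -/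
theorem iSup_iInf_eigenspace_toLin'_map_eq_top :
    ⨆ σ : K →+* ℂ, (⨅ y : K, Module.End.eigenspace (Matrix.toLin' ((f y).map (algebraMap ℚ ℂ))) (σ y)) = ⊤ :=
  iSup_iInf_eigenspace_eq_top
    ((Matrix.toLinAlgEquiv' : Matrix ι ι ℂ ≃ₐ[ℂ] Module.End ℂ (ι → ℂ)).toRingEquiv.toRingHom.comp
      (((algebraMap ℚ ℂ).mapMatrix).comp (f : K →+* Matrix ι ι ℚ)))

/-- **Milne 1999, Proposition 2.1 for the Betti theory over `k = ℂ`** ("`V(A)` is a free `L ⊗_ℚ k`-module of rank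
`2 dim A/[L:ℚ]`", i.e. all the summands `V_i = e_i V` have the same dimension `2g/[L:ℚ]`): for EVERY complex
embedding `σ` of `K`, `dim_ℂ V_σ · [K:ℚ] = |ι| = 2g`. [cite: Milne1999LefschetzClasses, §2 Prop. 2.1] [cite: MoonenZarhin1998WeilClasses, §3 (`r = 2g/[F:ℚ]`, (3))] -/
theorem finrank_iInf_eigenspace_toLin'_map_mul_finrank (σ : K →+* ℂ) :
    finrank ℂ ↥(⨅ y : K, Module.End.eigenspace (Matrix.toLin' ((f y).map (algebraMap ℚ ℂ))) (σ y)) * finrank ℚ K =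
      Fintype.card ι := by
  obtain ⟨θ, hθ⟩ := Field.exists_primitive_element ℚ K
  rw [iInf_eigenspace_toLin'_map_eq_eigenspace f hθ, ← (Field.primitive_element_iff_minpoly_natDegree_eq ℚ θ).mp hθ]
  exact finrank_eigenspace_toLin'_map_mul_natDegree f θ (aeval_embedding_minpoly σ θ)

/-- `Σ_σ dim_ℂ V_σ = |ι| = 2g`. [cite: MoonenZarhin1998WeilClasses, §3 (3)] -/
theorem sum_finrank_iInf_eigenspace_toLin'_map_eq :
    ∑ σ : K →+* ℂ, finrank ℂ ↥(⨅ y : K, Module.End.eigenspace (Matrix.toLin' ((f y).map (algebraMap ℚ ℂ))) (σ y)) =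
      Fintype.card ι := by
  rw [← Module.finrank_fintype_fun_eq_card ℂ]
  exact sum_finrank_iInf_eigenspace_eq
    ((Matrix.toLinAlgEquiv' : Matrix ι ι ℂ ≃ₐ[ℂ] Module.End ℂ (ι → ℂ)).toRingEquiv.toRingHom.comp
      (((algebraMap ℚ ℂ).mapMatrix).comp (f : K →+* Matrix ι ι ℚ)))

include f in
/-- "On equating the degrees, we find that `2 dim A = m[L:ℚ]`": `[K:ℚ] ∣ |ι|` for a number field embedded in
`M_ι(ℚ)` (cf. `finrank_dvd_card_of_le_endAlgRat` of `ComplexTorusEndomorphismSubfields` for subfields of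
`M_ι(ℚ)`). [cite: Milne1999LefschetzClasses, §2 Prop. 2.1 (proof, last sentence)] -/
theorem finrank_dvd_card_of_algHom [Nonempty ι] : finrank ℚ K ∣ Fintype.card ι := by
  obtain ⟨σ⟩ := (inferInstance : Nonempty (K →+* ℂ))
  exact Dvd.intro_left _ (finrank_iInf_eigenspace_toLin'_map_mul_finrank f σ)

end MatrixField

/-! ## §2 The tangent space: `T₀X = ⊕_σ T_σ`, the multiplicities `n_σ = dim T_σ`, and `n_σ + n_σ̄ = 2g/[K:ℚ]`
(MZ98 (3)) -/

section Torus

variable {ι : Type*} [Fintype ι] [DecidableEq ι] {E : Type*} [NormedAddCommGroup E] [NormedSpace ℂ E]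
  [FiniteDimensional ℂ E] (Φ : (ι → ℝ) ≃L[ℝ] E) {K : Type*} [Field K] [NumberField K]
  (f : K →ₐ[ℚ] Matrix ι ι ℚ) (hf : ∀ x, f x ∈ endAlgRat Φ)

omit [FiniteDimensional ℂ E] in
/-- The analytic representation `x ↦ ρ_a(f x)` of `K` on `T₀X = E`, written as the ring map
`K → End_ℚ(X) → End_ℂ^{cont}(E) → End_ℂ(E)`, is `x ↦ ρ_a(f x)`. [folklore] -/
private theorem tan_apply (x : K) :
    (ContinuousLinearMap.toLinearMapRingHom.comp
      ((analyticRepHom Φ).comp ((f : K →+* Matrix ι ι ℚ).codRestrict (endAlgRat Φ) hf))) x =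
      ((analyticRepHom Φ ⟨f x, hf x⟩ : E →L[ℂ] E) : E →ₗ[ℂ] E) := rfl

omit [FiniteDimensional ℂ E] in
/-- `ρ_a(f x)` is a semisimple endomorphism of `T₀X` (it is annihilated by the separable `P_{K/ℚ,x}`).
[cite: MoonenZarhin1998WeilClasses, §3 (3)] [cite: Milne1999LefschetzClasses, §2 proof of Prop. 2.1] -/
theorem isSemisimple_analyticRepHom (x : K) :
    Module.End.IsSemisimple ((analyticRepHom Φ ⟨f x, hf x⟩ : E →L[ℂ] E) : E →ₗ[ℂ] E) :=
  isSemisimple_apply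
    (ContinuousLinearMap.toLinearMapRingHom.comp
      ((analyticRepHom Φ).comp ((f : K →+* Matrix ι ι ℚ).codRestrict (endAlgRat Φ) hf))) x

/-- `T₀X = ⊕_μ ker(ρ_a(f x) − μ)`. [cite: MoonenZarhin1998WeilClasses, §3 (3)] -/
theorem iSup_eigenspace_analyticRepHom_eq_top (x : K) :
    ⨆ μ : ℂ, Module.End.eigenspace ((analyticRepHom Φ ⟨f x, hf x⟩ : E →L[ℂ] E) : E →ₗ[ℂ] E) μ = ⊤ :=
  iSup_eigenspace_eq_top
    (ContinuousLinearMap.toLinearMapRingHom.comp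
      ((analyticRepHom Φ).comp ((f : K →+* Matrix ι ι ℚ).codRestrict (endAlgRat Φ) hf))) x

omit [FiniteDimensional ℂ E] in
/-- Only conjugates of `x` are eigenvalues of `ρ_a(f x)`. [cite: MoonenZarhin1998WeilClasses, §3 (3)] -/
theorem eigenspace_analyticRepHom_eq_bot (x : K) {μ : ℂ} (hμ : aeval μ (minpoly ℚ x) ≠ 0) :
    Module.End.eigenspace ((analyticRepHom Φ ⟨f x, hf x⟩ : E →L[ℂ] E) : E →ₗ[ℂ] E) μ = ⊥ :=
  eigenspace_eq_bot_of_aeval_ne_zero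
    (ContinuousLinearMap.toLinearMapRingHom.comp
      ((analyticRepHom Φ).comp ((f : K →+* Matrix ι ι ℚ).codRestrict (endAlgRat Φ) hf))) x hμ

/-- `dim ker(ρ_a(f x) − μ) = mult_μ P^a_{f x}` (the analytic characteristic polynomial).
[cite: Lange2023AbelianVarietiesComplex, §2.4.1 Prop. 2.4.3 (a)] -/
theorem finrank_eigenspace_analyticRepHom_eq_rootMultiplicity (x : K) (μ : ℂ) :
    finrank ℂ ↥(Module.End.eigenspace ((analyticRepHom Φ ⟨f x, hf x⟩ : E →L[ℂ] E) : E →ₗ[ℂ] E) μ) =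
      ((analyticRepHom Φ ⟨f x, hf x⟩ : E →L[ℂ] E) : E →ₗ[ℂ] E).charpoly.rootMultiplicity μ :=
  finrank_eigenspace_eq_rootMultiplicity
    (ContinuousLinearMap.toLinearMapRingHom.comp
      ((analyticRepHom Φ).comp ((f : K →+* Matrix ι ι ℚ).codRestrict (endAlgRat Φ) hf))) x μ

omit [FiniteDimensional ℂ E] in
/-- For a generator `θ` of `K`: `T_σ = ker(ρ_a(f θ) − σθ)`. [cite: MoonenZarhin1998WeilClasses, §3 (3)] -/
theorem iInf_eigenspace_analyticRepHom_eq_eigenspace {θ : K} (hθ : ℚ⟮θ⟯ = ⊤) (σ : K →+* ℂ) :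
    (⨅ y : K, Module.End.eigenspace ((analyticRepHom Φ ⟨f y, hf y⟩ : E →L[ℂ] E) : E →ₗ[ℂ] E) (σ y)) =
      Module.End.eigenspace ((analyticRepHom Φ ⟨f θ, hf θ⟩ : E →L[ℂ] E) : E →ₗ[ℂ] E) (σ θ) :=
  iInf_eigenspace_eq_eigenspace
    (ContinuousLinearMap.toLinearMapRingHom.comp
      ((analyticRepHom Φ).comp ((f : K →+* Matrix ι ι ℚ).codRestrict (endAlgRat Φ) hf))) hθ σ

omit [FiniteDimensional ℂ E] in
/-- **`T₀X = ⊕_σ T_σ`, independence** of the `T_σ = {v ∈ T₀X | ρ_a(f y) v = σ(y) v ∀ y ∈ K}`.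
[cite: MoonenZarhin1998WeilClasses, §3 (3)] -/
theorem iSupIndep_iInf_eigenspace_analyticRepHom :
    iSupIndep fun σ : K →+* ℂ =>
      ⨅ y : K, Module.End.eigenspace ((analyticRepHom Φ ⟨f y, hf y⟩ : E →L[ℂ] E) : E →ₗ[ℂ] E) (σ y) :=
  iSupIndep_iInf_eigenspace
    (ContinuousLinearMap.toLinearMapRingHom.comp
      ((analyticRepHom Φ).comp ((f : K →+* Matrix ι ι ℚ).codRestrict (endAlgRat Φ) hf)))

/-- **`T₀X = ⊕_σ T_σ`, spanning.** [cite: MoonenZarhin1998WeilClasses, §3 (3)] -/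
theorem iSup_iInf_eigenspace_analyticRepHom_eq_top :
    ⨆ σ : K →+* ℂ,
      (⨅ y : K, Module.End.eigenspace ((analyticRepHom Φ ⟨f y, hf y⟩ : E →L[ℂ] E) : E →ₗ[ℂ] E) (σ y)) = ⊤ :=
  iSup_iInf_eigenspace_eq_top
    (ContinuousLinearMap.toLinearMapRingHom.comp
      ((analyticRepHom Φ).comp ((f : K →+* Matrix ι ι ℚ).codRestrict (endAlgRat Φ) hf)))

/-- `Σ_σ n_σ = dim_ℂ T₀X = g`. [cite: MoonenZarhin1998WeilClasses, §3 (3)] -/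
theorem sum_finrank_iInf_eigenspace_analyticRepHom_eq :
    ∑ σ : K →+* ℂ, finrank ℂ ↥(⨅ y : K,
        Module.End.eigenspace ((analyticRepHom Φ ⟨f y, hf y⟩ : E →L[ℂ] E) : E →ₗ[ℂ] E) (σ y)) =
      finrank ℂ E :=
  sum_finrank_iInf_eigenspace_eq
    (ContinuousLinearMap.toLinearMapRingHom.comp
      ((analyticRepHom Φ).comp ((f : K →+* Matrix ι ι ℚ).codRestrict (endAlgRat Φ) hf)))

/-- The single-element form of MZ98 (3): for `x ∈ K` with `f x ∈ End_ℚ(X)` and a conjugate `μ` of `x`,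
`(dim ker(ρ_a(f x) − μ) + dim ker(ρ_a(f x) − μ̄)) · deg P_{K/ℚ,x} = 2g` — from `P^r_{fx} = P^a_{fx} · \overline{P^a_{fx}}`
(Prop. 2.4.3 (a)) and §1. [cite: MoonenZarhin1998WeilClasses, §3 (3)] [cite: Lange2023AbelianVarietiesComplex, §2.4.1 Prop. 2.4.3 (a)] -/
theorem finrank_eigenspace_analyticRepHom_add_conj_mul_natDegree (x : K) {μ : ℂ}
    (hμ : aeval μ (minpoly ℚ x) = 0) :
    (finrank ℂ ↥(Module.End.eigenspace ((analyticRepHom Φ ⟨f x, hf x⟩ : E →L[ℂ] E) : E →ₗ[ℂ] E) μ) +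
      finrank ℂ ↥(Module.End.eigenspace ((analyticRepHom Φ ⟨f x, hf x⟩ : E →L[ℂ] E) : E →ₗ[ℂ] E) (conj μ))) *
        (minpoly ℚ x).natDegree = Fintype.card ι := by
  have hA := finrank_eigenspace_add_conj_eq
    (ContinuousLinearMap.toLinearMapRingHom.comp
      ((analyticRepHom Φ).comp ((f : K →+* Matrix ι ι ℚ).codRestrict (endAlgRat Φ) hf))) x μ
  have hC := finrank_eigenspace_eq_rootMultiplicity
    ((Matrix.toLinAlgEquiv' : Matrix ι ι ℂ ≃ₐ[ℂ] Module.End ℂ (ι → ℂ)).toRingEquiv.toRingHom.comp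
      (((algebraMap ℚ ℂ).mapMatrix).comp (f : K →+* Matrix ι ι ℚ))) x μ
  rw [cpx_apply] at hC
  rw [tan_apply, ← charpoly_map_eq_charpoly_analyticRepHom_mul_conj Φ ⟨f x, hf x⟩, ← charpoly_toLin'_map,
    ← hC] at hA
  have hB := finrank_eigenspace_toLin'_map_mul_natDegree f x hμ
  rw [← hA] at hB
  exact hB

/-- **Moonen–Zarhin 1998, (3): `n_σ + n_σ̄ = 2g/[K:ℚ]`** for every complex embedding `σ` of `K`, where
`n_σ = dim_ℂ T_σ` is "the multiplicity of `σ` on the tangent space of `X`" and `σ̄` the complex-conjugate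
embedding: `(n_σ + n_σ̄) · [K:ℚ] = |ι| = 2g`. Proof: `dim V_σ = mult_{σθ} P^r_{fθ} = mult_{σθ} P^a_{fθ} +
mult_{σ̄θ} P^a_{fθ} = n_σ + n_σ̄` (`P^r = P^a \overline{P^a}`, Prop. 2.4.3 (a)) and §1 `dim V_σ · [K:ℚ] = 2g`.
[cite: MoonenZarhin1998WeilClasses, §3 (3)] [cite: Lange2023AbelianVarietiesComplex, §2.4.1 Prop. 2.4.3 (a)] -/
theorem finrank_iInf_eigenspace_analyticRepHom_add_conjugate_mul_finrank (σ : K →+* ℂ) :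
    (finrank ℂ ↥(⨅ y : K,
        Module.End.eigenspace ((analyticRepHom Φ ⟨f y, hf y⟩ : E →L[ℂ] E) : E →ₗ[ℂ] E) (σ y)) +
      finrank ℂ ↥(⨅ y : K,
        Module.End.eigenspace ((analyticRepHom Φ ⟨f y, hf y⟩ : E →L[ℂ] E) : E →ₗ[ℂ] E)
          (NumberField.ComplexEmbedding.conjugate σ y))) * finrank ℚ K = Fintype.card ι := by
  obtain ⟨θ, hθ⟩ := Field.exists_primitive_element ℚ K
  have hA := finrank_iInf_eigenspace_add_conjugate_eq
    (ContinuousLinearMap.toLinearMapRingHom.comp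
      ((analyticRepHom Φ).comp ((f : K →+* Matrix ι ι ℚ).codRestrict (endAlgRat Φ) hf))) hθ σ
  have hC := finrank_eigenspace_eq_rootMultiplicity
    ((Matrix.toLinAlgEquiv' : Matrix ι ι ℂ ≃ₐ[ℂ] Module.End ℂ (ι → ℂ)).toRingEquiv.toRingHom.comp
      (((algebraMap ℚ ℂ).mapMatrix).comp (f : K →+* Matrix ι ι ℚ))) θ (σ θ)
  rw [cpx_apply] at hC
  rw [tan_apply, ← charpoly_map_eq_charpoly_analyticRepHom_mul_conj Φ ⟨f θ, hf θ⟩, ← charpoly_toLin'_map,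
    ← hC] at hA
  have hB := finrank_eigenspace_toLin'_map_mul_natDegree f θ (aeval_embedding_minpoly σ θ)
  rw [(Field.primitive_element_iff_minpoly_natDegree_eq ℚ θ).mp hθ, ← hA] at hB
  exact hB

/-- The same with `2g = 2 dim_ℂ T₀X` on the right: `(n_σ + n_σ̄) · [K:ℚ] = 2g`. [cite: MoonenZarhin1998WeilClasses, §3 (3)] -/
theorem finrank_iInf_eigenspace_analyticRepHom_add_conjugate_mul_finrank_eq_two_mul (σ : K →+* ℂ) :
    (finrank ℂ ↥(⨅ y : K,
        Module.End.eigenspace ((analyticRepHom Φ ⟨f y, hf y⟩ : E →L[ℂ] E) : E →ₗ[ℂ] E) (σ y)) +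
      finrank ℂ ↥(⨅ y : K,
        Module.End.eigenspace ((analyticRepHom Φ ⟨f y, hf y⟩ : E →L[ℂ] E) : E →ₗ[ℂ] E)
          (NumberField.ComplexEmbedding.conjugate σ y))) * finrank ℚ K = 2 * finrank ℂ E := by
  rw [finrank_iInf_eigenspace_analyticRepHom_add_conjugate_mul_finrank Φ f hf σ, card_eq_two_mul_finrank Φ]

/-- **Real embeddings have tangent multiplicity `g/[K:ℚ]`**: for a REAL embedding `σ` (`σ̄ = σ`) MZ98 (3) reads
`2 n_σ · [K:ℚ] = 2g`, i.e. `n_σ · [K:ℚ] = g = dim_ℂ T₀X` — in particular `[K:ℚ] ∣ g` as soon as `K ⊆ End_ℚ(X)`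
has a real place (Lange's "`e ∣ g`" for a totally real field of endomorphisms, the tree's
`finrank_dvd_finrank_of_ringHom_real` of `ComplexTorusRealMultiplicationDegree`, here with the explicit
multiplicity). [cite: MoonenZarhin1998WeilClasses, §3 (3)] [cite: Lange2023AbelianVarietiesComplex, §2.6.1 Prop. (p. 138, "`e ∣ g`")] -/
theorem finrank_iInf_eigenspace_analyticRepHom_mul_finrank_of_isReal {σ : K →+* ℂ}
    (hσ : NumberField.ComplexEmbedding.IsReal σ) :
    finrank ℂ ↥(⨅ y : K,
        Module.End.eigenspace ((analyticRepHom Φ ⟨f y, hf y⟩ : E →L[ℂ] E) : E →ₗ[ℂ] E) (σ y)) * finrank ℚ K =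
      finrank ℂ E := by
  have h := finrank_iInf_eigenspace_analyticRepHom_add_conjugate_mul_finrank_eq_two_mul Φ f hf σ
  rw [NumberField.ComplexEmbedding.isReal_iff.mp hσ, add_mul] at h
  omega

include hf in
/-- `[K:ℚ] ∣ g` for a number field `K ⊆ End_ℚ(X)` with a real place. [cite: Lange2023AbelianVarietiesComplex, §2.6.1 Prop. (p. 138, "`e ∣ g`")] [cite: MoonenZarhin1998WeilClasses, §3 (3)] -/
theorem finrank_dvd_finrank_of_isReal {σ : K →+* ℂ} (hσ : NumberField.ComplexEmbedding.IsReal σ) :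
    finrank ℚ K ∣ finrank ℂ E :=
  Dvd.intro_left _ (finrank_iInf_eigenspace_analyticRepHom_mul_finrank_of_isReal Φ f hf hσ)

end Torus

end ComplexTorus

end Literature.Geometry.Kaehler
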